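import Literature.IUT.LogThetaLattice.GlobalPacketsLGP
import Mathlib.Analysis.Real.Cardinality
import Mathlib.LinearAlgebra.FiniteDimensional.Defs
import HarnessLib

/-!
# [IUTchIII] Prop 3.3 (i): negative witness for the schema `Prop33i_directSumOfNumberFields'`

Negative knowledge recorded next to `Literature/IUT/LogThetaLattice/GlobalPacketsLGP.lean` (abc-iut
cell, L6 ruling D10 (c): "negative witnesses are WELCOME as proof-only companions"). The v2 append of
that file (p405527) introduced `Prop33i_directSumOfNumberFields'` intending to add the binder
`[∀ α, NumberField (F α)]` through a section `variable`; Lean does not include an unreferenced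
instance variable in a `def`, so the landed statement has the SAME signature as the unprimed schema
`Prop33i_directSumOfNumberFields` (finding G-BINDER-DROP, abc-iut-L6-t5, 2026-08-25). This file proves
that the landed statement is FALSE at the junk parameter `F := fun _ : Unit => ℝ` (one label, the
field `ℝ`): the global packet `⊗_{Unit} ℝ ≅ ℝ` is uncountable, whereas a finite product of number
fields is countable. The TRUE content — for number fields `F α` — is
`Prop33i_directSumOfNumberFields'_of_numberField` in `GlobalPacketsLGPProofs.lean` (p405908), which
carries the hypothesis explicitly. Mochizuki's Proposition 3.3 (i) ([IUTchIII] p. 100) concerns number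
fields `(†𝕄⊛_mod)_α ≅ F_mod`; nothing here bears on it or on Cor. 3.12 — this is a typing record only.
-/

namespace Literature.IUT.LogThetaLattice

open PiTensorProduct

/-- The landed schema `Prop33i_directSumOfNumberFields'` (binder `[NumberField]` silently dropped) is
refutable: at `A := Unit`, `F := fun _ => ℝ` the global tensor packet is `ℚ`-linearly isomorphic to
`ℝ`, hence uncountable, so it is not ring-isomorphic to a finite product of number fields (each
countable, being finite-dimensional over `ℚ`). [claim: Mochizuki2012, status: disputed] -/
theorem not_Prop33i_directSumOfNumberFields'_real :
    ¬ Prop33i_directSumOfNumberFields' (A := Unit) (fun _ => ℝ) := by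
  rintro ⟨ι, _, K, _, hK, ⟨e⟩⟩
  have hlin : (GlobalPacket fun _ : Unit => ℝ) ≃ₗ[ℚ] ℝ :=
    PiTensorProduct.subsingletonEquiv (R := ℚ) (s := fun _ : Unit => ℝ) ()
  have hcount : ∀ i, Countable (K i) := fun i => by
    haveI := hK i
    exact Countable.of_equiv _ (Module.finBasis ℚ (K i)).equivFun.toEquiv.symm
  have : Countable (GlobalPacket fun _ : Unit => ℝ) := Countable.of_equiv _ e.toEquiv.symm
  have : Countable ℝ := Countable.of_equiv _ hlin.toEquiv
  exact Cardinal.not_countable_real (Set.countable_univ_iff.mpr this)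

end Literature.IUT.LogThetaLattice
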